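import Mathlib
import Summits.RiemannHypothesis.RiemannHypothesis.Theorems.PfPersistenceAdmissibleClass
import Summits.RiemannHypothesis.RiemannHypothesis.Theorems.PfPersistenceF2PlantedIndex
import Summits.RiemannHypothesis.RiemannHypothesis.Theorems.PfPersistenceF2RealPairNodal

/-!
# F2 / P2-LOW — a planted quadruple BELOW the window's frequency resolution is even-NODAL

pub-rhpf fake seat 2, generation 3.  **Mechanism / rigidity campaign; no RH claims.**  Elementary and RH-free.
Extends `PfPersistenceF2RealPairNodal` (the real pair, `γ = 0`) to a planted quadruple `{½ ± η ± iγ}` of LOW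
height: `γ a ≤ π/2` at the window `[-a, a]` (more generally: `cos(γx) ≥ κ ≥ 0` on the window).

OBJECT.  The quadruple adds to ζ's EVEN Galerkin block the nonnegative rank-two matrix `σ (r rᵀ + i iᵀ)`,
`r_n = ∫ ξ_n e^{ηx} cos(γx)`, `i_n = ∫ ξ_n e^{ηx} sin(γx)` (`lowPlantedRe`, `lowPlantedIm`; `σ ≥ 0` the planted
weight in the user's convention).

THEOREM (`le_eigenvalue_of_oneSigned_low`).  `Q` any nonnegative form, `σ ≥ 0`, `0 ≤ κ ≤ cos(γx)` on the window,
`u ≠ 0` an eigenvector of `Q + σ (r rᵀ + i iᵀ)` with eigenvalue `λ`:  `OneSigned (2a) u → σ κ² a/(N+1) ≤ λ`.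
With `0 ≤ γ`, `γ a ≤ π/2` one may take `κ = cos(γ a)` (`cos_height_lower`); Datum level:
`lowPlanted_not_mem_oneSignedAt`.  So a low planted quadruple whose even bottom value is `< σ cos²(γa) a/(N+1)`
has a NODAL even bottom vector: the even SHAPE tier sees every sub-resolution planted quadruple that it sees at
all in energy order `ε₂⁺(ζ)` (FAKES §2.7; interlacing `λ₁ ≤ ε₃⁺(ζ)` for rank two).

PROOF.  `λ|u|² = uᵀQu + σ(⟨r,u⟩² + ⟨i,u⟩²) ≥ σ⟨r,u⟩²`; `⟨r,u⟩ = ∫ θ_u e^{ηx} cos(γx) = ∫ θ_u cosh(ηx) cos(γx)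
≥ κ ∫ θ_u` for `θ_u ≥ 0`; and `∫ θ_u ≥ |u| (a/(N+1))^{1/2}` by Parseval on the window as in the real-pair file.
-/

namespace Summit.RiemannHypothesis.RiemannHypothesis.Theorems.PfPersistenceF2LowPlantedNodal

open Matrix BigOperators Real MeasureTheory intervalIntegral Set
open Summit.RiemannHypothesis.RiemannHypothesis.Theorems.PfPersistence
open Summit.RiemannHypothesis.RiemannHypothesis.Theorems.PfPersistenceF2PlantedIndex (vecMulVec_mulVec_eq)
open Summit.RiemannHypothesis.RiemannHypothesis.Theorems.PfPersistenceF2RealPairNodal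

section MatrixStep

variable {n : Type*} [Fintype n]

/-- For an eigenvector `x` of `Q + σ (r rᵀ + i iᵀ)` (eigenvalue `λ`, `Q` a nonnegative form, `σ ≥ 0`):
`σ ⟨r,x⟩² ≤ λ |x|²`. [folklore] -/
theorem sigma_sq_dot_le₂ (Q : Matrix n n ℝ) (hQ : ∀ v, 0 ≤ v ⬝ᵥ (Q *ᵥ v)) (r i x : n → ℝ) {σ lam : ℝ}
    (hσ : 0 ≤ σ) (hx : (Q + σ • (vecMulVec r r + vecMulVec i i)) *ᵥ x = lam • x) :
    σ * (r ⬝ᵥ x) ^ 2 ≤ lam * (x ⬝ᵥ x) := by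
  have h1 : x ⬝ᵥ ((Q + σ • (vecMulVec r r + vecMulVec i i)) *ᵥ x) = lam * (x ⬝ᵥ x) := by
    rw [hx, dotProduct_smul, smul_eq_mul]
  simp only [add_mulVec, Matrix.smul_mulVec, vecMulVec_mulVec_eq, smul_add, dotProduct_add, dotProduct_smul,
    smul_eq_mul] at h1
  rw [dotProduct_comm x r, dotProduct_comm x i] at h1
  have h2 : (r ⬝ᵥ x) ^ 2 = (r ⬝ᵥ x) * (r ⬝ᵥ x) := sq _
  nlinarith [hQ x, mul_nonneg hσ (mul_self_nonneg (i ⬝ᵥ x))]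

end MatrixStep

section LowPlanted

variable (L : ℝ) {N : ℕ}

/-- Real part of the planted coefficient vector of `½ + η + iγ` in Connes' even basis on `[-L/2, L/2]`:
`r_n = ∫ ξ_n(x) e^{ηx} cos(γx) dx`. -/
noncomputable def lowPlantedRe (η γ : ℝ) (L : ℝ) (N : ℕ) : Fin (N + 1) → ℝ :=
  fun n => ∫ x in -(L / 2)..(L / 2), xiEven L n x * (Real.exp (η * x) * Real.cos (γ * x))

/-- Imaginary part: `i_n = ∫ ξ_n(x) e^{ηx} sin(γx) dx`. -/
noncomputable def lowPlantedIm (η γ : ℝ) (L : ℝ) (N : ℕ) : Fin (N + 1) → ℝ :=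
  fun n => ∫ x in -(L / 2)..(L / 2), xiEven L n x * (Real.exp (η * x) * Real.sin (γ * x))

/-- `⟨r, u⟩ = ∫ θ_u(x) e^{ηx} cos(γx) dx`. -/
theorem lowPlantedRe_dotProduct (η γ : ℝ) (u : Fin (N + 1) → ℝ) :
    lowPlantedRe η γ L N ⬝ᵥ u
      = ∫ x in -(L / 2)..(L / 2), profile L u x * (Real.exp (η * x) * Real.cos (γ * x)) := by
  have h1 : (fun x => profile L u x * (Real.exp (η * x) * Real.cos (γ * x)))
      = fun x => ∑ n : Fin (N + 1), u n * (xiEven L n x * (Real.exp (η * x) * Real.cos (γ * x))) := by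
    funext x
    rw [show profile L u x = ∑ n : Fin (N + 1), u n * xiEven L n x from rfl, Finset.sum_mul]
    apply Finset.sum_congr rfl; intro n _; ring
  rw [h1, intervalIntegral.integral_finsetSum]
  · simp only [dotProduct, lowPlantedRe]
    apply Finset.sum_congr rfl
    intro n _
    rw [intervalIntegral.integral_const_mul, mul_comm]
  · intro n _
    apply Continuous.intervalIntegrable
    exact continuous_const.mul ((continuous_xiEven L n).mul (by fun_prop))

/-- If `θ_u ≥ 0` on the window and `0 ≤ κ ≤ cos(γx)` there, then `κ ∫ θ_u ≤ ⟨r, u⟩`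
(symmetrise `e^{ηx}` to `cosh(ηx) ≥ 1`; `θ_u cos(γ·)` is even). -/
theorem integral_profile_le_dot_low (η γ κ : ℝ) (u : Fin (N + 1) → ℝ)
    (hpos : ∀ x ∈ Icc (-(L / 2)) (L / 2), 0 ≤ profile L u x) (hκ0 : 0 ≤ κ)
    (hκ : ∀ x ∈ Icc (-(L / 2)) (L / 2), κ ≤ Real.cos (γ * x)) (hL : 0 < L) :
    κ * ∫ x in -(L / 2)..(L / 2), profile L u x ≤ lowPlantedRe η γ L N ⬝ᵥ u := by
  have hab : -(L / 2) ≤ L / 2 := by linarith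
  have hcp := continuous_profile L u
  have hsym : ∫ x in -(L / 2)..(L / 2), profile L u x * (Real.exp (-(η * x)) * Real.cos (γ * x))
      = ∫ x in -(L / 2)..(L / 2), profile L u x * (Real.exp (η * x) * Real.cos (γ * x)) := by
    have h := intervalIntegral.integral_comp_neg (a := -(L / 2)) (b := L / 2)
      (f := fun x => profile L u x * (Real.exp (η * x) * Real.cos (γ * x)))
    simp only [neg_neg] at h
    rw [← h]
    congr 1; funext x
    rw [profile_neg, mul_neg, mul_neg, Real.cos_neg]
  have hcosh : lowPlantedRe η γ L N ⬝ᵥ u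
      = ∫ x in -(L / 2)..(L / 2), profile L u x * (Real.cosh (η * x) * Real.cos (γ * x)) := by
    rw [lowPlantedRe_dotProduct]
    have h2 : (fun x => profile L u x * (Real.cosh (η * x) * Real.cos (γ * x)))
        = fun x => (profile L u x * (Real.exp (η * x) * Real.cos (γ * x))
            + profile L u x * (Real.exp (-(η * x)) * Real.cos (γ * x))) / 2 := by
      funext x; rw [Real.cosh_eq]; ring
    have hi1 : IntervalIntegrable (fun x => profile L u x * (Real.exp (η * x) * Real.cos (γ * x)))
        volume (-(L / 2)) (L / 2) := by
      apply Continuous.intervalIntegrable; exact hcp.mul (by fun_prop)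
    have hi2 : IntervalIntegrable (fun x => profile L u x * (Real.exp (-(η * x)) * Real.cos (γ * x)))
        volume (-(L / 2)) (L / 2) := by
      apply Continuous.intervalIntegrable; exact hcp.mul (by fun_prop)
    rw [h2, intervalIntegral.integral_div, intervalIntegral.integral_add hi1 hi2, hsym]
    ring
  rw [hcosh, ← intervalIntegral.integral_const_mul]
  have hi3 : IntervalIntegrable (fun x => profile L u x * (Real.cosh (η * x) * Real.cos (γ * x)))
      volume (-(L / 2)) (L / 2) := by
    apply Continuous.intervalIntegrable; exact hcp.mul (by fun_prop)
  have hi4 : IntervalIntegrable (fun x => κ * profile L u x) volume (-(L / 2)) (L / 2) := by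
    apply Continuous.intervalIntegrable; exact continuous_const.mul hcp
  apply intervalIntegral.integral_mono_on hab hi4 hi3
  intro x hx
  have hθ := hpos x hx
  have hc := hκ x hx
  have h1 : κ ≤ Real.cosh (η * x) * Real.cos (γ * x) := by
    have hcos0 : 0 ≤ Real.cos (γ * x) := le_trans hκ0 hc
    calc κ ≤ Real.cos (γ * x) := hc
      _ = 1 * Real.cos (γ * x) := (one_mul _).symm
      _ ≤ Real.cosh (η * x) * Real.cos (γ * x) := mul_le_mul_of_nonneg_right (Real.one_le_cosh _) hcos0
  calc κ * profile L u x = profile L u x * κ := mul_comm _ _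
    _ ≤ profile L u x * (Real.cosh (η * x) * Real.cos (γ * x)) := mul_le_mul_of_nonneg_left h1 hθ

/-- On the window `[-L/2, L/2]`, if `0 ≤ γ` and `γ L/2 ≤ π/2` then `cos(γ L/2) ≤ cos(γx)` (and it is `≥ 0`). -/
theorem cos_height_lower {γ : ℝ} (hγ0 : 0 ≤ γ) (hγ : γ * (L / 2) ≤ π / 2) (x : ℝ)
    (hx : x ∈ Icc (-(L / 2)) (L / 2)) : Real.cos (γ * (L / 2)) ≤ Real.cos (γ * x) := by
  rw [← Real.cos_abs (γ * x)]
  have h1 : |γ * x| ≤ γ * (L / 2) := by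
    rw [abs_mul, abs_of_nonneg hγ0]
    exact mul_le_mul_of_nonneg_left (abs_le.mpr ⟨by linarith [hx.1], hx.2⟩) hγ0
  apply Real.cos_le_cos_of_nonneg_of_le_pi (abs_nonneg _) _ h1
  linarith [Real.pi_pos]

/-- `cos(γ L/2) ≥ 0` under the same hypotheses. -/
theorem cos_height_nonneg (hL : 0 < L) {γ : ℝ} (hγ0 : 0 ≤ γ) (hγ : γ * (L / 2) ≤ π / 2) :
    0 ≤ Real.cos (γ * (L / 2)) :=
  Real.cos_nonneg_of_neg_pi_div_two_le_of_le
    (by linarith [Real.pi_pos, mul_nonneg hγ0 (by linarith : (0 : ℝ) ≤ L / 2)]) hγ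

/-- MAIN INEQUALITY (positive branch): `Q` a nonnegative form, `σ ≥ 0`, `0 ≤ κ ≤ cos(γx)` on the window,
`u ≠ 0` an eigenvector of `Q + σ (r rᵀ + i iᵀ)` with eigenvalue `λ` and profile `≥ 0` on the window:
`σ κ² L / (2 (N+1)) ≤ λ`. [folklore] -/
theorem le_eigenvalue_of_profile_nonneg_low (hL : 0 < L) (Q : Matrix (Fin (N + 1)) (Fin (N + 1)) ℝ)
    (hQ : ∀ v, 0 ≤ v ⬝ᵥ (Q *ᵥ v)) {σ lam : ℝ} (η γ κ : ℝ) (hσ : 0 ≤ σ) (hκ0 : 0 ≤ κ)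
    (hκ : ∀ x ∈ Icc (-(L / 2)) (L / 2), κ ≤ Real.cos (γ * x)) (u : Fin (N + 1) → ℝ) (hu0 : u ≠ 0)
    (hu : (Q + σ • (vecMulVec (lowPlantedRe η γ L N) (lowPlantedRe η γ L N)
      + vecMulVec (lowPlantedIm η γ L N) (lowPlantedIm η γ L N))) *ᵥ u = lam • u)
    (hpos : ∀ x ∈ Icc (-(L / 2)) (L / 2), 0 ≤ profile L u x) :
    σ * κ ^ 2 * L / (2 * (N + 1)) ≤ lam := by
  set r := lowPlantedRe η γ L N with hr
  set K : ℝ := (N + 1) * (2 / L) with hK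
  have hab : -(L / 2) ≤ L / 2 := by linarith
  have hcp := continuous_profile L u
  have hK0 : 0 < K := mul_pos (by positivity) (div_pos two_pos hL)
  have huu : 0 < u ⬝ᵥ u := by
    rcases Function.ne_iff.mp hu0 with ⟨j, hj⟩
    have hj' : u j ≠ 0 := by simpa using hj
    have hsq : 0 < u j ^ 2 := by rw [sq]; exact mul_self_pos.mpr hj'
    have : u ⬝ᵥ u = ∑ n, u n ^ 2 := by simp [dotProduct, sq]
    rw [this]
    exact lt_of_lt_of_le hsq (Finset.single_le_sum (fun n _ => sq_nonneg (u n)) (Finset.mem_univ j))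
  have hA : σ * (r ⬝ᵥ u) ^ 2 ≤ lam * (u ⬝ᵥ u) := sigma_sq_dot_le₂ Q hQ r (lowPlantedIm η γ L N) u hσ hu
  set M := Real.sqrt ((u ⬝ᵥ u) * K) with hM
  have hM0 : 0 < M := Real.sqrt_pos.mpr (mul_pos huu hK0)
  have hMsq : M ^ 2 = (u ⬝ᵥ u) * K := Real.sq_sqrt (mul_pos huu hK0).le
  have hθM : ∀ x ∈ Icc (-(L / 2)) (L / 2), profile L u x ≤ M := by
    intro x hx
    exact (Real.le_sqrt (hpos x hx) (mul_pos huu hK0).le).mpr (profile_sq_le L hL u x)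
  set I := ∫ x in -(L / 2)..(L / 2), profile L u x with hI
  have hpars : ∫ x in -(L / 2)..(L / 2), profile L u x ^ 2 = u ⬝ᵥ u := integral_profile_sq L hL u
  have h1 : u ⬝ᵥ u ≤ M * I := by
    rw [← hpars, hI, ← intervalIntegral.integral_const_mul]
    have hi4 : IntervalIntegrable (fun x => profile L u x ^ 2) volume (-(L / 2)) (L / 2) := by
      apply Continuous.intervalIntegrable; exact hcp.pow 2
    have hi5 : IntervalIntegrable (fun x => M * profile L u x) volume (-(L / 2)) (L / 2) := by
      apply Continuous.intervalIntegrable; exact continuous_const.mul hcp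
    apply intervalIntegral.integral_mono_on hab hi4 hi5
    intro x hx
    rw [sq]
    exact mul_le_mul_of_nonneg_right (hθM x hx) (hpos x hx)
  have h2 : κ * I ≤ r ⬝ᵥ u := integral_profile_le_dot_low L η γ κ u hpos hκ0 hκ hL
  have hI0 : 0 < I := by
    by_contra h
    linarith [mul_nonpos_of_nonneg_of_nonpos hM0.le (not_lt.mp h)]
  have hκI : 0 ≤ κ * I := mul_nonneg hκ0 hI0.le
  have h3 : κ ^ 2 * (u ⬝ᵥ u) ^ 2 ≤ M ^ 2 * (r ⬝ᵥ u) ^ 2 := by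
    calc κ ^ 2 * (u ⬝ᵥ u) ^ 2 ≤ κ ^ 2 * (M * I) ^ 2 := by gcongr
      _ = M ^ 2 * (κ * I) ^ 2 := by ring
      _ ≤ M ^ 2 * (r ⬝ᵥ u) ^ 2 := by gcongr
  rw [hMsq] at h3
  have h4 : κ ^ 2 * (u ⬝ᵥ u) ≤ K * (r ⬝ᵥ u) ^ 2 := by
    have h5 : (u ⬝ᵥ u) * (κ ^ 2 * (u ⬝ᵥ u)) ≤ (u ⬝ᵥ u) * (K * (r ⬝ᵥ u) ^ 2) := by nlinarith [h3]
    exact le_of_mul_le_mul_left h5 huu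
  have h6 : σ * κ ^ 2 * (u ⬝ᵥ u) ≤ K * (lam * (u ⬝ᵥ u)) := by
    calc σ * κ ^ 2 * (u ⬝ᵥ u) = σ * (κ ^ 2 * (u ⬝ᵥ u)) := by ring
      _ ≤ σ * (K * (r ⬝ᵥ u) ^ 2) := mul_le_mul_of_nonneg_left h4 hσ
      _ = K * (σ * (r ⬝ᵥ u) ^ 2) := by ring
      _ ≤ K * (lam * (u ⬝ᵥ u)) := mul_le_mul_of_nonneg_left hA hK0.le
  have h7 : σ * κ ^ 2 ≤ K * lam := le_of_mul_le_mul_right (by linarith) huu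
  have h8 : σ * κ ^ 2 * L / (2 * (N + 1)) = σ * κ ^ 2 / K := by rw [hK]; field_simp
  rw [h8, div_le_iff₀ hK0]; linarith

/-- MAIN THEOREM, either sign: `OneSigned L u → σ κ² L/(2(N+1)) ≤ λ`. [folklore] -/
theorem le_eigenvalue_of_oneSigned_low (hL : 0 < L) (Q : Matrix (Fin (N + 1)) (Fin (N + 1)) ℝ)
    (hQ : ∀ v, 0 ≤ v ⬝ᵥ (Q *ᵥ v)) {σ lam : ℝ} (η γ κ : ℝ) (hσ : 0 ≤ σ) (hκ0 : 0 ≤ κ)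
    (hκ : ∀ x ∈ Icc (-(L / 2)) (L / 2), κ ≤ Real.cos (γ * x)) (u : Fin (N + 1) → ℝ) (hu0 : u ≠ 0)
    (hu : (Q + σ • (vecMulVec (lowPlantedRe η γ L N) (lowPlantedRe η γ L N)
      + vecMulVec (lowPlantedIm η γ L N) (lowPlantedIm η γ L N))) *ᵥ u = lam • u)
    (h1 : OneSigned L u) : σ * κ ^ 2 * L / (2 * (N + 1)) ≤ lam := by
  rcases h1 with hpos | hneg
  · exact le_eigenvalue_of_profile_nonneg_low L hL Q hQ η γ κ hσ hκ0 hκ u hu0 hu hpos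
  · have hu' : (Q + σ • (vecMulVec (lowPlantedRe η γ L N) (lowPlantedRe η γ L N)
        + vecMulVec (lowPlantedIm η γ L N) (lowPlantedIm η γ L N))) *ᵥ (-u) = lam • (-u) := by
      rw [mulVec_neg, hu, smul_neg]
    refine le_eigenvalue_of_profile_nonneg_low L hL Q hQ η γ κ hσ hκ0 hκ (-u) (neg_ne_zero.mpr hu0) hu' ?_
    intro x hx
    rw [profile_neg_vec]
    linarith [hneg x hx]

/-- Contrapositive: an eigenvector with `λ < σ κ² L/(2(N+1))` is NODAL. [folklore] -/
theorem not_oneSigned_of_eigenvalue_lt_low (hL : 0 < L) (Q : Matrix (Fin (N + 1)) (Fin (N + 1)) ℝ)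
    (hQ : ∀ v, 0 ≤ v ⬝ᵥ (Q *ᵥ v)) {σ lam : ℝ} (η γ κ : ℝ) (hσ : 0 ≤ σ) (hκ0 : 0 ≤ κ)
    (hκ : ∀ x ∈ Icc (-(L / 2)) (L / 2), κ ≤ Real.cos (γ * x)) (u : Fin (N + 1) → ℝ) (hu0 : u ≠ 0)
    (hu : (Q + σ • (vecMulVec (lowPlantedRe η γ L N) (lowPlantedRe η γ L N)
      + vecMulVec (lowPlantedIm η γ L N) (lowPlantedIm η γ L N))) *ᵥ u = lam • u)
    (hlam : lam < σ * κ ^ 2 * L / (2 * (N + 1))) : ¬ OneSigned L u :=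
  fun h1 => absurd (le_eigenvalue_of_oneSigned_low L hL Q hQ η γ κ hσ hκ0 hκ u hu0 hu h1) (not_le.mpr hlam)

end LowPlanted

section DatumLevel

/-- Datum level.  ζ's block at `win` a nonnegative form (certified DATA per served window); the datum's block
is ζ's plus `σ (r rᵀ + i iᵀ)` for the planted quadruple `{½ ± η ± iγ}` with `0 ≤ γ`, `γ a ≤ π/2` (height below
the window's resolution); bottom Rayleigh value `< σ cos²(γa) a/(N+1)` ⟹ NOT in the one-signed class at `win`
(the even bottom vector is nodal). [folklore] -/
theorem lowPlanted_not_mem_oneSignedAt (win : Window) (hζ : ∀ v, 0 ≤ v ⬝ᵥ (zetaDatum win *ᵥ v))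
    {σ : ℝ} (η γ : ℝ) (hσ : 0 ≤ σ) (hγ0 : 0 ≤ γ) (hγ : γ * win.a ≤ π / 2) (d : Datum)
    (hd : d win = zetaDatum win
      + σ • (vecMulVec (lowPlantedRe η γ (2 * win.a) win.N) (lowPlantedRe η γ (2 * win.a) win.N)
        + vecMulVec (lowPlantedIm η γ (2 * win.a) win.N) (lowPlantedIm η γ (2 * win.a) win.N)))
    (hlam : bottomRayleigh (d win) < σ * Real.cos (γ * win.a) ^ 2 * win.a / (win.N + 1)) :
    d ∉ oneSignedAt win := by
  rintro ⟨u, ⟨hu0, hbot⟩, h1⟩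
  have hL : 0 < 2 * win.a := by linarith [win.ha]
  have hhalf : 2 * win.a / 2 = win.a := by ring
  have hγ' : γ * (2 * win.a / 2) ≤ π / 2 := by rw [hhalf]; exact hγ
  have hκ0 : 0 ≤ Real.cos (γ * (2 * win.a / 2)) := cos_height_nonneg (2 * win.a) hL hγ0 hγ'
  have hκ : ∀ x ∈ Icc (-(2 * win.a / 2)) (2 * win.a / 2),
      Real.cos (γ * (2 * win.a / 2)) ≤ Real.cos (γ * x) :=
    fun x hx => cos_height_lower (2 * win.a) hγ0 hγ' x hx
  have hu : (zetaDatum win + σ • (vecMulVec (lowPlantedRe η γ (2 * win.a) win.N)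
      (lowPlantedRe η γ (2 * win.a) win.N) + vecMulVec (lowPlantedIm η γ (2 * win.a) win.N)
      (lowPlantedIm η γ (2 * win.a) win.N))) *ᵥ u = bottomRayleigh (d win) • u := by rw [← hd]; exact hbot
  have h := le_eigenvalue_of_oneSigned_low (2 * win.a) hL (zetaDatum win) hζ η γ _ hσ hκ0 hκ u hu0 hu h1
  rw [hhalf] at h
  have h' : σ * Real.cos (γ * win.a) ^ 2 * (2 * win.a) / (2 * (win.N + 1))
      = σ * Real.cos (γ * win.a) ^ 2 * win.a / (win.N + 1) := by field_simp
  exact absurd (h'.symm ▸ h) (not_le.mpr hlam)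

end DatumLevel

end Summit.RiemannHypothesis.RiemannHypothesis.Theorems.PfPersistenceF2LowPlantedNodal
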